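import Mathlib
import Literature.Computability.AlgebraicComplexity.HessianAtOrigin
import Summits.ValiantsHypothesis.ValiantsHypothesis.Theorems.GrenetZeonTwoDimCoefficientsUnitCase
import Summits.ValiantsHypothesis.ValiantsHypothesis.Theorems.GrenetZeonTwoDimCoefficientsScalingClosure

/-!
# Crux `GrenetZeon.TwoDimCoefficients` (stmt-ValiantsHypothesis-8062), stub `stub_dualUnipotent`:
# scaling-closure — the SCALING ALGEBRA (homogenisation, slices, coefficients of `det (X·V + U)`)

Generic lemmas feeding the construction of the scaling family (file `…ScalingRung`):

* affine polynomials: `f = f(0) + f₁` (`eq_C_add_homogeneousComponent_one`), the value at a dilated point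
  (`eval_inv_smul_of_affine`), and the POINTWISE HOMOGENISATION identity
  `(δ·f(0) + f₁(z))|_{(z,δ₀)} = δ₀·f(z/δ₀)` (`eval_homog_eq`), plus affineness of its `δ := δ₀` slice
  (`totalDegree_aeval_homog_le`);
* slice calculus on `ℂ[z, δ]` (`δ` = the coordinate `none` of `Option σ`): evaluation at `(z, δ₀)` is
  evaluation of the `δ := δ₀` specialisation (`eval_aeval_slice`), `z`-partials commute with the
  specialisation (`eval_pderiv_some_slice`, by uniqueness of derivatives along lines in the slice,
  ✓ `hasDerivAt_eval_line`), hence so does the `z`-Hessian (`hessian_slice`);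
* coefficients of `det (X·V + U) ∈ R[X]`: compatibility with ring maps and evaluation
  (`map_det_X_smul_add`, `eval_det_X_smul_add`), `[X^0] = det U` (`coeff_det_zero`), scaling
  (`coeff_det_smul`), ★ `[X^1] = tr(adj U·V)` for `det U` a unit (`coeff_det_one`, Jacobi via Mathlib
  `coeff_det_one_add_X_smul_one`), and the expansion `det (r·V + U) = Σ_k [X^k]·r^k`
  (`det_smul_add_eq_sum_coeff`).

HONEST FRAMING: bookkeeping lemmas; nothing about the permanent, the stub, the crux or `VP ≠ VNP`.

References: C. G. J. Jacobi (adjugate formula; Mathlib `Matrix.coeff_det_one_add_X_smul_one`); folklore.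
-/

-- single-conjunct layout `Summits/ValiantsHypothesis/ValiantsHypothesis`: the duplicated namespace
-- component is mandated by the tree.
set_option linter.dupNamespace false
set_option autoImplicit false

noncomputable section

namespace Summit.ValiantsHypothesis.ValiantsHypothesis.Theorems.GrenetZeonTwoDimCoefficients.ScalingClosure

open MvPolynomial Matrix Filter Topology
open Literature.Computability.AlgebraicComplexity
open Summit.ValiantsHypothesis.ValiantsHypothesis.Cruxes.TwoDimCoefficients.DimTwoCases

/-! ### Affine polynomials and their `δ`-homogenisation (pointwise) -/

section Homog

variable {σ : Type*} [Fintype σ] [DecidableEq σ]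

omit [Fintype σ] [DecidableEq σ] in
/-- An affine polynomial is its constant term plus its linear part. [folklore] -/
theorem eq_C_add_homogeneousComponent_one {f : MvPolynomial σ ℂ} (hf : f.totalDegree ≤ 1) :
    f = MvPolynomial.C (coeff 0 f) + homogeneousComponent 1 f := by
  rcases Nat.le_one_iff_eq_zero_or_eq_one.mp hf with h0 | h1
  · have h := sum_homogeneousComponent f
    rw [h0, Finset.sum_range_one, homogeneousComponent_zero] at h
    have hz : homogeneousComponent 1 f = 0 :=
      homogeneousComponent_eq_zero (n := 1) (φ := f) (by omega)
    rw [hz, add_zero]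
    exact h.symm
  · have h := sum_homogeneousComponent f
    rw [h1, Finset.sum_range_succ, Finset.sum_range_one, homogeneousComponent_zero] at h
    exact h.symm

omit [DecidableEq σ] in
/-- Value of an affine polynomial at a dilated point: `f(d⁻¹·z) = f(0) + d⁻¹·f₁(z)`. [folklore] -/
theorem eval_inv_smul_of_affine {f : MvPolynomial σ ℂ} (hf : f.totalDegree ≤ 1) (d : ℂ)
    (z : σ → ℂ) :
    eval (d⁻¹ • z) f = coeff 0 f + d⁻¹ * eval z (homogeneousComponent 1 f) := by
  conv_lhs => rw [eq_C_add_homogeneousComponent_one hf]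
  rw [map_add, MvPolynomial.eval_C,
    eval_smul_of_isHomogeneous _ (homogeneousComponent_isHomogeneous 1 f), pow_one]

omit [DecidableEq σ] in
/-- **Pointwise homogenisation.**  The `δ`-homogenisation `δ·f(0) + f₁(z)` of an affine `f`, evaluated
at `(z, δ₀)` with `δ₀ ≠ 0`, equals `δ₀·f(z/δ₀)`. [folklore] -/
theorem eval_homog_eq {f : MvPolynomial σ ℂ} (hf : f.totalDegree ≤ 1) {d : ℂ} (hd : d ≠ 0)
    (z : σ → ℂ) :
    eval (fun o : Option σ => o.elim d z)
        (rename some (homogeneousComponent 1 f) + MvPolynomial.C (coeff 0 f) * X none) =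
      d * eval (d⁻¹ • z) f := by
  have hcomp : ((fun o : Option σ => o.elim d z) ∘ some) = z := funext fun _ => rfl
  rw [map_add, map_mul, MvPolynomial.eval_C, MvPolynomial.eval_X, MvPolynomial.eval_rename, hcomp,
    eval_inv_smul_of_affine hf, mul_add, ← mul_assoc, mul_inv_cancel₀ hd, one_mul]
  simp only [Option.elim]
  ring

omit [Fintype σ] [DecidableEq σ] in
/-- The `δ := δ₀` specialisation of the homogenisation of an affine `f` is affine. [folklore] -/
theorem totalDegree_aeval_homog_le {f : MvPolynomial σ ℂ} (d : ℂ) :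
    (aeval (fun o : Option σ => o.elim (MvPolynomial.C d) X)
        (rename some (homogeneousComponent 1 f) + MvPolynomial.C (coeff 0 f) * X none)).totalDegree
      ≤ 1 := by
  rw [map_add, map_mul, MvPolynomial.aeval_C, MvPolynomial.aeval_X, MvPolynomial.aeval_rename]
  have hcomp : ((fun o : Option σ => o.elim (MvPolynomial.C d) X) ∘ some) =
      (X : σ → MvPolynomial σ ℂ) := funext fun _ => rfl
  rw [hcomp, MvPolynomial.aeval_X_left_apply]
  simp only [Option.elim, MvPolynomial.algebraMap_eq]
  refine (totalDegree_add _ _).trans (max_le ?_ ?_)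
  · exact (homogeneousComponent_isHomogeneous 1 f).totalDegree_le
  · rw [← map_mul]
    exact (totalDegree_C _).le.trans zero_le_one

end Homog

/-! ### Slice calculus: specialising `δ` commutes with `z`-evaluation and `z`-partials -/

section Slice

variable {σ : Type*} [Fintype σ] [DecidableEq σ]

omit [Fintype σ] [DecidableEq σ] in
/-- Evaluation at `(z, δ₀)` is evaluation at `z` of the `δ := δ₀` specialisation. [folklore] -/
theorem eval_aeval_slice (F : MvPolynomial (Option σ) ℂ) (d : ℂ) (z : σ → ℂ) :
    eval z (aeval (fun o : Option σ => o.elim (MvPolynomial.C d) X) F) =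
      eval (fun o : Option σ => o.elim d z) F := by
  induction F using MvPolynomial.induction_on with
  | C a => simp
  | add p q hp hq => simp only [map_add, hp, hq]
  | mul_X p o hp =>
    rw [map_mul, map_mul, hp, map_mul, MvPolynomial.aeval_X, MvPolynomial.eval_X]
    cases o with
    | none => simp
    | some s => simp

omit [Fintype σ] in
/-- The line `t ↦ (z, δ₀) + t·e_{some i}` lies in the slice `δ = δ₀`. [folklore] -/
theorem elim_add_smul_single' (d : ℂ) (z : σ → ℂ) (i : σ) (t : ℂ) :
    (fun o : Option σ => o.elim d z) + t • (Pi.single (some i) (1 : ℂ) : Option σ → ℂ) =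
      fun o : Option σ => o.elim d (z + t • (Pi.single i (1 : ℂ) : σ → ℂ)) := by
  funext o
  cases o with
  | none => simp
  | some s =>
    by_cases hs : s = i
    · subst hs
      simp
    · simp [hs]

omit [Fintype σ] in
/-- **`z`-partials commute with the specialisation `δ := δ₀`** (uniqueness of derivatives along lines in
the slice; ✓ `hasDerivAt_eval_line`). [folklore] -/
theorem eval_pderiv_some_slice (P : MvPolynomial (Option σ) ℂ) (R : MvPolynomial σ ℂ) (d : ℂ)
    (h : ∀ z : σ → ℂ, eval (fun o : Option σ => o.elim d z) P = eval z R) (z : σ → ℂ) (i : σ) :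
    eval (fun o : Option σ => o.elim d z) (pderiv (some i) P) = eval z (pderiv i R) := by
  have h1 := hasDerivAt_eval_line P (fun o : Option σ => o.elim d z) (some i)
  have h2 := hasDerivAt_eval_line R z i
  have h3 : (fun t : ℂ => eval ((fun o : Option σ => o.elim d z) +
      t • (Pi.single (some i) (1 : ℂ) : Option σ → ℂ)) P) =
      fun t : ℂ => eval (z + t • (Pi.single i (1 : ℂ) : σ → ℂ)) R := by
    funext t
    rw [elim_add_smul_single', h]
  rw [h3] at h1
  exact h1.unique h2

omit [Fintype σ] in
/-- Second `z`-partials on a slice: the `z`-Hessian of `P` at `(z, δ₀)` is the Hessian of the slice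
polynomial at `z`. [folklore] -/
theorem hessian_slice (P : MvPolynomial (Option σ) ℂ) (R : MvPolynomial σ ℂ) (d : ℂ)
    (h : ∀ z : σ → ℂ, eval (fun o : Option σ => o.elim d z) P = eval z R) (z : σ → ℂ) :
    (Matrix.of fun s t : σ => pderiv (some s) (pderiv (some t) P)).map
        (eval (fun o : Option σ => o.elim d z)) = hess0 (transl z R) := by
  ext s t
  rw [Matrix.map_apply, Matrix.of_apply, hess0_transl]
  exact eval_pderiv_some_slice (pderiv (some t) P) (pderiv t R) d
    (fun z' => eval_pderiv_some_slice P R d h z' t) z s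

end Slice

/-! ### Coefficients of `det (X·V + U)` -/

section DetCoeff

variable {R S : Type*} [CommRing R] [CommRing S] {ι : Type*} [Fintype ι] [DecidableEq ι]

/-- `det (X·V + U)` is compatible with ring maps on coefficients. [folklore] -/
theorem map_det_X_smul_add (φ : R →+* S) (U V : Matrix ι ι R) :
    (det ((Polynomial.X : Polynomial R) • V.map Polynomial.C + U.map Polynomial.C)).map φ =
      det ((Polynomial.X : Polynomial S) • (V.map φ).map Polynomial.C + (U.map φ).map Polynomial.C) := by
  rw [← Polynomial.coe_mapRingHom, RingHom.map_det, RingHom.mapMatrix_apply]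
  congr 1
  ext i j
  simp only [Matrix.map_apply, Matrix.add_apply, Matrix.smul_apply, smul_eq_mul,
    Polynomial.coe_mapRingHom, Polynomial.map_add, Polynomial.map_mul, Polynomial.map_X,
    Polynomial.map_C]

/-- Evaluating `det (X·V + U)` at `X := r` gives `det (r·V + U)`. [folklore] -/
theorem eval_det_X_smul_add (r : R) (U V : Matrix ι ι R) :
    (det ((Polynomial.X : Polynomial R) • V.map Polynomial.C + U.map Polynomial.C)).eval r = det (r • V + U) := by
  rw [← Polynomial.coe_evalRingHom, RingHom.map_det, RingHom.mapMatrix_apply]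
  congr 1
  ext i j
  simp only [Matrix.map_apply, Matrix.add_apply, Matrix.smul_apply, smul_eq_mul,
    Polynomial.coe_evalRingHom, Polynomial.eval_add, Polynomial.eval_mul, Polynomial.eval_X,
    Polynomial.eval_C]

/-- `[X^0] det (X·V + U) = det U`. [folklore] -/
theorem coeff_det_zero (U V : Matrix ι ι R) :
    (det ((Polynomial.X : Polynomial R) • V.map Polynomial.C + U.map Polynomial.C)).coeff 0 = det U := by
  rw [Polynomial.coeff_zero_eq_eval_zero, eval_det_X_smul_add, zero_smul, zero_add]

/-- Scaling both matrices scales every coefficient by `d^m`. [folklore] -/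
theorem coeff_det_smul (d : R) (U V : Matrix ι ι R) (k : ℕ) :
    (det ((Polynomial.X : Polynomial R) • (d • V).map Polynomial.C + (d • U).map Polynomial.C)).coeff k =
      d ^ Fintype.card ι * (det ((Polynomial.X : Polynomial R) • V.map Polynomial.C + U.map Polynomial.C)).coeff k := by
  have h : (Polynomial.X : Polynomial R) • (d • V).map Polynomial.C + (d • U).map Polynomial.C =
      Polynomial.C d • ((Polynomial.X : Polynomial R) • V.map Polynomial.C + U.map Polynomial.C) := by
    ext i j
    simp only [Matrix.add_apply, Matrix.smul_apply, Matrix.map_apply, smul_eq_mul]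
    rw [Polynomial.C_mul, Polynomial.C_mul]
    ring
  rw [h, det_smul, ← Polynomial.C_pow, Polynomial.coeff_C_mul]

/-- **`[X^1] det (X·B + A) = tr(adj A·B)`** when `det A` is a unit (Jacobi; Mathlib
`coeff_det_one_add_X_smul_one` after factoring `A`). [folklore] -/
theorem coeff_det_one (U V : Matrix ι ι R) (hU : IsUnit U.det) :
    (det ((Polynomial.X : Polynomial R) • V.map Polynomial.C + U.map Polynomial.C)).coeff 1 =
      (U.adjugate * V).trace := by
  have hinv : U * U⁻¹ = 1 := U.mul_nonsing_inv hU
  have hfac : (Polynomial.X : Polynomial R) • V.map Polynomial.C + U.map Polynomial.C =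
      U.map Polynomial.C * (1 + (Polynomial.X : Polynomial R) • (U⁻¹ * V).map Polynomial.C) := by
    rw [Matrix.mul_add, Matrix.mul_one, Matrix.mul_smul, ← Matrix.map_mul, ← Matrix.mul_assoc,
      hinv, Matrix.one_mul, add_comm]
  have hdetC : (U.map Polynomial.C).det = Polynomial.C U.det := by
    rw [RingHom.map_det Polynomial.C U, RingHom.mapMatrix_apply]
  rw [hfac, det_mul, hdetC, Polynomial.coeff_C_mul, coeff_det_one_add_X_smul_one]
  have hadj : U.adjugate = U.det • U⁻¹ := by
    rw [Matrix.inv_def, smul_smul, Ring.mul_inverse_cancel _ hU, one_smul]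
  rw [hadj, Matrix.smul_mul, trace_smul, smul_eq_mul]

/-- `det (X·V + U) = Σ_{k ≤ m} [X^k]·r^k` at `X := r`. [folklore] -/
theorem det_smul_add_eq_sum_coeff (r : R) (U V : Matrix ι ι R) :
    det (r • V + U) = ∑ k ∈ Finset.range (Fintype.card ι + 1),
      (det ((Polynomial.X : Polynomial R) • V.map Polynomial.C + U.map Polynomial.C)).coeff k * r ^ k := by
  rw [← eval_det_X_smul_add, Polynomial.eval_eq_sum_range'
    (Nat.lt_succ_of_le (Polynomial.natDegree_det_X_add_C_le V U))]

end DetCoeff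

end Summit.ValiantsHypothesis.ValiantsHypothesis.Theorems.GrenetZeonTwoDimCoefficients.ScalingClosure

end
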